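/-
Copyright: the b2b-balaban T⁴-continuum CRUX team, row NE7b OWNER lineage `t4-ne7b-p1` (gen 122). Project licence.
-/
import Summits.QuantumFields.BalabanUV.T4Continuum.Spine.NE7b.SupTorusPerturbedKernelSums

/-!
# BLOCK-TO-BLOCK LOCALITY OF `(H + K)⁻¹` FOR AN EXPONENTIALLY DECAYING KERNEL `K` — (131)'s weighted letter with the road's weight and
# (138)'s block `ℓ²` locality, RE-RUN for the perturbed Hessian: `|K(x,z)| ≤ εe^{−γρ_N(x,z)}`, `κ < γ`, `εK_{γ−κ} < m_κ` ⟹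
# `‖e^{(κ∕(n+1))ρ_N(·,c)}u‖₂ ≤ (m_κ − εK_{γ−κ})⁻¹‖e^{(κ∕(n+1))ρ_N(·,c)}f‖₂` for `(H + K)u = f`, and for `f` supported in one block `y₀`
# `Σ_{B_y}u² ≤ (m_κ − εK_{γ−κ})⁻²e^{4dκ}e^{−2κρ_s(y,y₀)}Σf²` — every mesh, every volume: the first two files of the locality column hold for
# the class of Hessians the road's step PRODUCES (row NE7b, node U5c; (131)∕(132)∕(133)∕(138)∕(163) BY NAME; [folklore])

Cell `pub-balaban`, sub-cell `t4`, spine estimate NE7b (`T4WeightBudget.RelWeightBound`; the cell's OWN estimate — NOT PRINTED in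
[Bałaban 1983–89], NOT PROVED).  Crux-route work under `Spine/NE7b/` by the row OWNER (`t4-ne7b-p1` gen 122, file (164)) under FREEZE
(0)'s crux-prover clause; NOTHING of Bałaban's is named as a Lean object, valued or asserted; no `T4Continuum/Support` leaf typed; no `def`,
no notation (the action and the kernel sum DISPLAYED); zero `sorry`.  Imports (BY NAME): the OWNER's (163) `…SupTorusPerturbedKernelSums`
(`decaying_kernel_resolvent_le`, `distance_weight_lipschitz`; through it (162), (131) `weight_bond_letter`, `weight_block_letter`, (132)
`torusDist_bond_lipschitz`, `isPseudoDist_torus`, (133) `weight_on_block`, `block_sum_le_total`, `sum_indicator_mul`).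

WHY (located).  (162)∕(163) produced the perturbed resolvent letter abstractly; this file instantiates it with the road's Combes–Thomas weight
`(κ∕(n+1))ρ_N(·, c)` (bond letter `κ∕(n+1)`, block letter `2dκ` by (131), `κ`-Lipschitz for `ρ_N` by (163)) and repeats (138)'s two-line
block reading (source block weight `≤ e^{dκ}`, target block weight `≥ e^{κρ_s − dκ}`, (133) `weight_on_block`).  From here every file of
the locality ∕ pointwise ∕ volume columns can be re-run for `H + K` by replacing (138) with §2.

WHAT IS PROVED ([folklore]; fine torus `Site d ((n+1)s)`, coarse `Site d s`; `m_κ = min(2,a) − λ − 2dκ² − a(e^{2dκ} − 1)`, `K_α = (2∕(1 − e^{−α}))^d`;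
`(H + K)u = f` DISPLAYED with the kernel term `Σ_z K x z·u z`):
* §1 **`perturbed_inverseHessian_weighted_resolvent`** (`a ≥ 0`, `0 ≤ κ ≤ 1`, `κ < γ`, `ε ≥ 0`, `V ≥ −λ`, `|K x z| ≤ εe^{−γρ_N(x,z)}`,
  `εK_{γ−κ} < m_κ`: for every centre `c`, `‖e^{(κ∕(n+1))ρ_N(·,c)}u‖₂ ≤ (m_κ − εK_{γ−κ})⁻¹‖e^{(κ∕(n+1))ρ_N(·,c)}f‖₂`).
* §2 **`perturbed_blockSq_le_of_block_source`** (`f` supported in the block `y₀` ⟹ `Σ_z u(σ(chart (wm y) z))² ≤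
  (m_κ − εK_{γ−κ})⁻²e^{4dκ}e^{−2κρ_s(y,y₀)}Σ_x f x²` over EVERY block `y`).
* §3 toy.

HONEST (what this is NOT).  The first two letters of the column for `H + K`; the Schur complement, coarse floor, next-scale operator,
response, covariance, pointwise and volume letters for `H + K` are NOT re-derived here; cubic periods; scalar skeleton ((A3), NC-NE7b-α
UNRULED); nothing of Bałaban's.  BY-NAME EFFECT ON THE WALL: NONE.  NE7b NOT PRINTED ∕ NOT PROVED; spine PROVED 0∕9; rung (B)+1 on a FINITE
torus — NOT infinite volume, NOT the mass gap, NOT Clay.  HONEST DEPENDENCY: continuum YM on T⁴ ⇐ BetaPertH ∧ nine spine estimates (0∕9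
proved); BetaPertH ⇐ (D1) ∧ (D4) ∧ CAP+tail; G-an2-4 gates asym, D1 and NE2∕3∕4.
-/

set_option autoImplicit false

noncomputable section

namespace Summit.QuantumFields.BalabanUV.T4Continuum.NE7b.SupTorusPerturbedLocality

open Real
open Literature.MathematicalPhysics.QuantumFieldTheory.Balaban1983to89
open B6QGQLower276 (X e blk B side chart mem_B sum_B sum_B_const card_cube blk_chart)
open Beta (Site siteOf windowMap siteOf_windowMap siteOf_add)
open SupTorusHessianCombesThomas (weight_bond_letter weight_block_letter)
open SupTorusBlockDistance (isPseudoDist_torus torusDist_bond_lipschitz)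
open SupTorusActionForm (weight_on_block block_sum_le_total sum_indicator_mul)
open SupTorusPerturbedKernelSums (decaying_kernel_resolvent_le distance_weight_lipschitz)

variable {d : ℕ}

section Perturbed

variable (n : ℕ) (a : ℝ) (s : ℕ) [NeZero s] (ha : 0 ≤ a) {lam κ ε γ : ℝ} (hκ0 : 0 ≤ κ) (hκ1 : κ ≤ 1) (hκγ : κ < γ) (hε : 0 ≤ ε)
  (hm : ε * (2 * (1 - exp (-(γ - κ)))⁻¹) ^ d < min 2 a - lam - 2 * d * κ ^ 2 - a * (exp (2 * d * κ) - 1))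
  (V : Site d ((n + 1) * s) → ℝ) (hV : ∀ x, -lam ≤ V x)
  (K : Site d ((n + 1) * s) → Site d ((n + 1) * s) → ℝ)
  (hK : ∀ x z, |K x z| ≤ ε * exp (-(γ * ∑ i, (((x i - z i).valMinAbs.natAbs : ℕ) : ℝ))))
  (u f : Site d ((n + 1) * s) → ℝ)
  (hu : ∀ x, ((n : ℝ) + 1) ^ 2 * ∑ μ, (2 * u x - u (x + siteOf d ((n + 1) * s) (e μ)) - u (x - siteOf d ((n + 1) * s) (e μ)))
      + a / ((n : ℝ) + 1) ^ d * ∑ q ∈ B n (blk n (windowMap d ((n + 1) * s) x)), u (siteOf d ((n + 1) * s) q)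
      + V x * u x + ∑ z, K x z * u z = f x)

/-! ## §1. The road's weight in the perturbed resolvent letter -/

include ha hκ0 hκ1 hκγ hε hm hV hK hu in
/-- **THE WEIGHTED RESOLVENT LETTER OF `(H + K)⁻¹` WITH THE ROAD'S WEIGHT**: for every centre `c`,
`‖e^{(κ∕(n+1))ρ_N(·,c)}u‖₂ ≤ (m_κ − εK_{γ−κ})⁻¹·‖e^{(κ∕(n+1))ρ_N(·,c)}f‖₂` ((163) `decaying_kernel_resolvent_le` with (131)'s bond∕block letters and
the `κ`-Lipschitz letter of the distance weight). [folklore] -/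
theorem perturbed_inverseHessian_weighted_resolvent (c : Site d ((n + 1) * s)) :
    √(∑ x, (exp (κ / ((n : ℝ) + 1) * ∑ i, (((x i - c i).valMinAbs.natAbs : ℕ) : ℝ)) * u x) ^ 2)
      ≤ (min 2 a - lam - 2 * d * κ ^ 2 - a * (exp (2 * d * κ) - 1) - ε * (2 * (1 - exp (-(γ - κ)))⁻¹) ^ d)⁻¹
        * √(∑ x, (exp (κ / ((n : ℝ) + 1) * ∑ i, (((x i - c i).valMinAbs.natAbs : ℕ) : ℝ)) * f x) ^ 2) := by
  have hn : (0 : ℝ) < (n : ℝ) + 1 := by positivity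
  have hτ : κ / ((n : ℝ) + 1) ≤ 1 := (div_le_one hn).2 (hκ1.trans (by linarith))
  have hτ' : ((n : ℝ) + 1) * (κ / ((n : ℝ) + 1)) = κ := by field_simp
  have hθ0 : 0 ≤ κ / ((n : ℝ) + 1) := by positivity
  have hθκ : κ / ((n : ℝ) + 1) ≤ κ := div_le_self hκ0 (by linarith)
  set ρ : Site d ((n + 1) * s) → ℝ := fun x => ∑ i, (((x i - c i).valMinAbs.natAbs : ℕ) : ℝ) with hρ_def
  have hρ : ∀ x μ, |ρ (x + siteOf d ((n + 1) * s) (e μ)) - ρ x| ≤ 1 := fun x μ => torusDist_bond_lipschitz ((n + 1) * s) x c μ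
  -- the Lipschitz letter at rate `κ` (from rate `κ∕(n+1)` and `ρ_N ≥ 0`)
  have hwL : ∀ x z, |κ / ((n : ℝ) + 1) * ρ x - κ / ((n : ℝ) + 1) * ρ z| ≤ κ * ∑ i, (((x i - z i).valMinAbs.natAbs : ℕ) : ℝ) := by
    intro x z
    have h := distance_weight_lipschitz ((n + 1) * s) hθ0 c x z
    have hρxz : 0 ≤ ∑ i, (((x i - z i).valMinAbs.natAbs : ℕ) : ℝ) := Finset.sum_nonneg fun _ _ => Nat.cast_nonneg _
    exact h.trans (mul_le_mul_of_nonneg_right hθκ hρxz)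
  have hm' : ε * (2 * (1 - exp (-(γ - κ)))⁻¹) ^ d
      < min 2 a - lam - 2 * d * (((n : ℝ) + 1) * (κ / ((n : ℝ) + 1))) ^ 2 - a * (exp (2 * d * κ) - 1) := by rwa [hτ']
  have h := decaying_kernel_resolvent_le n a s ha u (fun x => κ / ((n : ℝ) + 1) * ρ x) V f K hτ (weight_bond_letter n s ρ hρ hκ0)
    (weight_block_letter n s ρ hρ hκ0) hwL hV hε hκγ hK hm' hu
  rw [hτ'] at h
  exact h

/-! ## §2. Block-to-block locality of `(H + K)⁻¹` -/

include ha hκ0 hκ1 hκγ hε hm hV hK hu in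
/-- **BLOCK-TO-BLOCK LOCALITY OF `(H + K)⁻¹`**: if `(H + K)u = f` with `f` supported in the block `y₀`, then over EVERY block `y`:
`Σ_z u(σ(chart (wm y) z))² ≤ (m_κ − εK_{γ−κ})⁻²·e^{4dκ}·e^{−2κρ_s(y,y₀)}·Σ_x f x²` — §1 with the centre at the corner of `y₀`, (133) `weight_on_block`
((138)'s reading verbatim with the perturbed floor). [folklore] -/
theorem perturbed_blockSq_le_of_block_source (y₀ : Site d s)
    (hf : ∀ x, siteOf d s (blk n (windowMap d ((n + 1) * s) x)) ≠ y₀ → f x = 0) (y : Site d s) :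
    ∑ z : Fin d → Fin (n + 1), u (siteOf d ((n + 1) * s) (chart n (windowMap d s y) z)) ^ 2
      ≤ ((min 2 a - lam - 2 * d * κ ^ 2 - a * (exp (2 * d * κ) - 1) - ε * (2 * (1 - exp (-(γ - κ)))⁻¹) ^ d)⁻¹) ^ 2 * exp (4 * d * κ)
        * exp (-(2 * κ * ∑ i, (((y i - y₀ i).valMinAbs.natAbs : ℕ) : ℝ))) * ∑ x, f x ^ 2 := by
  classical
  set m := min 2 a - lam - 2 * d * κ ^ 2 - a * (exp (2 * d * κ) - 1) - ε * (2 * (1 - exp (-(γ - κ)))⁻¹) ^ d with hm_def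
  have hm0 : 0 < m := by rw [hm_def]; linarith
  set c' : Site d ((n + 1) * s) := siteOf d ((n + 1) * s) (chart n (windowMap d s y₀) 0) with hc'
  have hres := perturbed_inverseHessian_weighted_resolvent n a s ha hκ0 hκ1 hκγ hε hm V hV K hK u f hu c'
  -- the source: supported in the block `y₀`, where the weight is `≤ e^{dκ}`
  have hsrc : ∑ x, (exp (κ / ((n : ℝ) + 1) * ∑ i, (((x i - c' i).valMinAbs.natAbs : ℕ) : ℝ)) * f x) ^ 2 ≤ exp (2 * d * κ) * ∑ x, f x ^ 2 := by
    have e1 : ∀ x, (exp (κ / ((n : ℝ) + 1) * ∑ i, (((x i - c' i).valMinAbs.natAbs : ℕ) : ℝ)) * f x) ^ 2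
        = (if siteOf d s (blk n (windowMap d ((n + 1) * s) x)) = y₀ then (1 : ℝ) else 0)
          * (exp (κ / ((n : ℝ) + 1) * ∑ i, (((x i - c' i).valMinAbs.natAbs : ℕ) : ℝ)) ^ 2 * f x ^ 2) := by
      intro x
      by_cases hx : siteOf d s (blk n (windowMap d ((n + 1) * s) x)) = y₀
      · rw [if_pos hx, one_mul, mul_pow]
      · rw [if_neg hx, hf x hx]; ring
    have e2 : ∀ x, f x ^ 2 = (if siteOf d s (blk n (windowMap d ((n + 1) * s) x)) = y₀ then (1 : ℝ) else 0) * f x ^ 2 := by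
      intro x
      by_cases hx : siteOf d s (blk n (windowMap d ((n + 1) * s) x)) = y₀
      · rw [if_pos hx, one_mul]
      · rw [if_neg hx, hf x hx]; ring
    rw [Finset.sum_congr rfl fun x _ => e1 x, sum_indicator_mul n s y₀,
      Finset.sum_congr rfl fun x (_ : x ∈ Finset.univ) => e2 x, sum_indicator_mul n s y₀, Finset.mul_sum]
    refine Finset.sum_le_sum fun z _ => mul_le_mul_of_nonneg_right ?_ (sq_nonneg _)
    have hw := (weight_on_block n s y₀ y₀ z hκ0).2
    rw [(isPseudoDist_torus (d := d) s).zero y₀, mul_zero, zero_add] at hw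
    rw [← exp_nat_mul, Nat.cast_ofNat]
    exact exp_le_exp.2 (by simp only [hc'] at hw ⊢; linarith)
  -- the solution on the block `y`: weights `≥ e^{κρ_s − dκ}`
  have hsol : exp (2 * (κ * (∑ i, (((y i - y₀ i).valMinAbs.natAbs : ℕ) : ℝ)) - d * κ))
        * ∑ z : Fin d → Fin (n + 1), u (siteOf d ((n + 1) * s) (chart n (windowMap d s y) z)) ^ 2
      ≤ ∑ x, (exp (κ / ((n : ℝ) + 1) * ∑ i, (((x i - c' i).valMinAbs.natAbs : ℕ) : ℝ)) * u x) ^ 2 := by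
    rw [Finset.mul_sum]
    refine le_trans (Finset.sum_le_sum fun z _ => ?_)
      (block_sum_le_total n s y (F := fun x => (exp (κ / ((n : ℝ) + 1) * ∑ i, (((x i - c' i).valMinAbs.natAbs : ℕ) : ℝ)) * u x) ^ 2)
        fun x => sq_nonneg _)
    have hw := (weight_on_block n s y y₀ z hκ0).1
    simp only [hc']
    rw [mul_pow, ← exp_nat_mul, Nat.cast_ofNat]
    exact mul_le_mul_of_nonneg_right (exp_le_exp.2 (by linarith)) (sq_nonneg _)
  -- combine
  have hS0 : 0 ≤ ∑ x, (exp (κ / ((n : ℝ) + 1) * ∑ i, (((x i - c' i).valMinAbs.natAbs : ℕ) : ℝ)) * u x) ^ 2 :=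
    Finset.sum_nonneg fun _ _ => sq_nonneg _
  have hF0 : 0 ≤ ∑ x, (exp (κ / ((n : ℝ) + 1) * ∑ i, (((x i - c' i).valMinAbs.natAbs : ℕ) : ℝ)) * f x) ^ 2 :=
    Finset.sum_nonneg fun _ _ => sq_nonneg _
  have hsq : ∑ x, (exp (κ / ((n : ℝ) + 1) * ∑ i, (((x i - c' i).valMinAbs.natAbs : ℕ) : ℝ)) * u x) ^ 2
      ≤ (m⁻¹) ^ 2 * (exp (2 * d * κ) * ∑ x, f x ^ 2) := by
    have h1 := pow_le_pow_left₀ (Real.sqrt_nonneg _) hres 2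
    rw [Real.sq_sqrt hS0, mul_pow, Real.sq_sqrt hF0] at h1
    exact h1.trans (mul_le_mul_of_nonneg_left hsrc (sq_nonneg _))
  have hexp : 0 < exp (2 * (κ * (∑ i, (((y i - y₀ i).valMinAbs.natAbs : ℕ) : ℝ)) - d * κ)) := exp_pos _
  have key : ∑ z : Fin d → Fin (n + 1), u (siteOf d ((n + 1) * s) (chart n (windowMap d s y) z)) ^ 2
      ≤ (m⁻¹) ^ 2 * (exp (2 * d * κ) * ∑ x, f x ^ 2) / exp (2 * (κ * (∑ i, (((y i - y₀ i).valMinAbs.natAbs : ℕ) : ℝ)) - d * κ)) := by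
    rw [le_div_iff₀ hexp, mul_comm]
    exact hsol.trans hsq
  refine key.trans (le_of_eq ?_)
  rw [div_eq_iff hexp.ne']
  have hE : exp (4 * d * κ) * exp (-(2 * κ * ∑ i, (((y i - y₀ i).valMinAbs.natAbs : ℕ) : ℝ)))
      * exp (2 * (κ * (∑ i, (((y i - y₀ i).valMinAbs.natAbs : ℕ) : ℝ)) - d * κ)) = exp (2 * d * κ) := by
    rw [← exp_add, ← exp_add]; congr 1; ring
  calc (m⁻¹) ^ 2 * (exp (2 * d * κ) * ∑ x, f x ^ 2) = (m⁻¹) ^ 2 * (exp (4 * d * κ)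
        * exp (-(2 * κ * ∑ i, (((y i - y₀ i).valMinAbs.natAbs : ℕ) : ℝ)))
        * exp (2 * (κ * (∑ i, (((y i - y₀ i).valMinAbs.natAbs : ℕ) : ℝ)) - d * κ))) * ∑ x, f x ^ 2 := by rw [hE]; ring
    _ = _ := by ring

end Perturbed

/-! ## §3. Toy -/

/-- Toy (`d = 0`, `a = 1`, `λ = 0`, `κ = 0`, `γ = 1`, `ε = 0`): the floor hypothesis `εK_{γ−κ} < m_κ` is inhabited. -/
example : (0 : ℝ) * (2 * (1 - exp (-((1 : ℝ) - 0)))⁻¹) ^ (0 : ℕ)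
    < min 2 (1 : ℝ) - 0 - 2 * ((0 : ℕ) : ℝ) * (0 : ℝ) ^ 2 - 1 * (exp (2 * ((0 : ℕ) : ℝ) * (0 : ℝ)) - 1) := by
  norm_num

end Summit.QuantumFields.BalabanUV.T4Continuum.NE7b.SupTorusPerturbedLocality
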